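import Literature.NumberTheory.Transcendental.CyclotomicSimplexRep
import Literature.NumberTheory.Transcendental.KZLogCalculusProofs

/-!
# `ZhaoRelationInKZ` (stmt-KontsevichZagierPeriods-9433, route `OctahedralSymmetry`), line `Sketch`:
# stub `stub_conj` (the free conjugation rows)

Complex conjugation of every letter of a level-4 word (`LevelFour.conjWord`, pole `i^m ↦ i^{-m}`,
i.e. the letter table `LevelFour.conjLetter = ![0, 3, 2, 1, 4]`) conjugates the complex word
integrand `∏ⱼ (tⱼ - pole Wⱼ)⁻¹` pointwise for real `t` (the letter tables satisfy
`re_{m̄} = re_m`, `im_{m̄} = -im_m`). Hence, for a 3-letter word `W = (m₀, m₁, m₂)` and its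
conjugate `W̄`, on the common domain `KZ.openOrderedSimplex 3`:
* the real-part representations `KZ.levelFourRepRe W̄`, `KZ.levelFourRepRe W` have the same
  integrand, so `[Re W̄] - [Re W] ∈ KZ.relations` (integrand additivity, rule (1));
* the imaginary-part representations have opposite integrands, so `[Im W̄] + [Im W] ∈ KZ.relations`;
* if `W̄ = W` the imaginary integrand vanishes identically, so `[Im W] ∈ KZ.relations`.
For a non-convergent word (`W` is convergent iff `W̄` is, since conjugation fixes the poles `1`
and `0`) all classes are `0`.

References: M. Kontsevich, D. Zagier, *Periods* (2001), §1.2 rule (1); J. Zhao, *Standard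
relations of multiple polylogarithm values at roots of unity*, Doc. Math. 15 (2010), §§1–2.
-/

noncomputable section

open Set MeasureTheory
open Literature.NumberTheory.Transcendental Literature.NumberTheory.Transcendental.KZ

namespace Summit.KontsevichZagierPeriods.OctahedralSymmetry.ZhaoRelationInKZ

/-- The real-part letter table is invariant under letter conjugation: `re_{m̄}(t) = re_m(t)`.
[folklore] -/
theorem stub_conj_levelFourRe (m : Fin 5) (t : ℝ) :
    levelFourRe (LevelFour.conjLetter m) t = levelFourRe m t := by
  fin_cases m <;> rfl

/-- The imaginary-part letter table is odd under letter conjugation: `im_{m̄}(t) = -im_m(t)`.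
[folklore] -/
theorem stub_conj_levelFourIm (m : Fin 5) (t : ℝ) :
    levelFourIm (LevelFour.conjLetter m) t = -levelFourIm m t := by
  fin_cases m
  · exact neg_zero.symm
  · show -1 / (1 + t ^ 2) = -(1 / (1 + t ^ 2))
    rw [neg_div]
  · exact neg_zero.symm
  · show 1 / (1 + t ^ 2) = -(-1 / (1 + t ^ 2))
    rw [neg_div, neg_neg]
  · exact neg_zero.symm

/-- Letter conjugation conjugates the complex letter `re_m(t) + i·im_m(t) = 1/(t - pole m)` for
real `t`. [folklore] -/
theorem stub_conj_levelFourFactor (m : Fin 5) (t : ℝ) :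
    levelFourFactor (LevelFour.conjLetter m) t = starRingEnd ℂ (levelFourFactor m t) := by
  apply Complex.ext
  · simp [levelFourFactor, stub_conj_levelFourRe]
  · simp [levelFourFactor, stub_conj_levelFourIm]

/-- The complex integrand of an explicit 3-letter word, expanded as a triple product.
[cite: Zhao2010, §1 eq. (2)] -/
theorem stub_conj_integrandC_three (a b c : Fin 5) (t : Fin 3 → ℝ) :
    levelFourIntegrandC [a, b, c] t =
      levelFourFactor a (t 0) * levelFourFactor b (t 1) * levelFourFactor c (t 2) := by
  show levelFourProd (n := 3) [a, b, c].get t = _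
  rw [levelFourProd, Fin.prod_univ_three]
  rfl

/-- Conjugating all three letters conjugates the complex word integrand pointwise (real `t`).
[folklore] -/
theorem stub_conj_integrandC_conjWord (m₀ m₁ m₂ : Fin 5) (t : Fin 3 → ℝ) :
    levelFourIntegrandC (LevelFour.conjWord [m₀, m₁, m₂]) t =
      starRingEnd ℂ (levelFourIntegrandC [m₀, m₁, m₂] t) := by
  show levelFourIntegrandC
      [LevelFour.conjLetter m₀, LevelFour.conjLetter m₁, LevelFour.conjLetter m₂] t = _
  rw [stub_conj_integrandC_three, stub_conj_integrandC_three, map_mul, map_mul,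
    stub_conj_levelFourFactor, stub_conj_levelFourFactor, stub_conj_levelFourFactor]

/-- The real-part integrands of a 3-letter word and of its conjugate agree. [folklore] -/
theorem stub_conj_integrandRe_conjWord (m₀ m₁ m₂ : Fin 5) (t : Fin 3 → ℝ) :
    levelFourIntegrandRe (LevelFour.conjWord [m₀, m₁, m₂]) t =
      levelFourIntegrandRe [m₀, m₁, m₂] t := by
  unfold levelFourIntegrandRe
  rw [stub_conj_integrandC_conjWord, Complex.conj_re]

/-- The imaginary-part integrands of a 3-letter word and of its conjugate are opposite.
[folklore] -/
theorem stub_conj_integrandIm_conjWord (m₀ m₁ m₂ : Fin 5) (t : Fin 3 → ℝ) :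
    levelFourIntegrandIm (LevelFour.conjWord [m₀, m₁, m₂]) t =
      -levelFourIntegrandIm [m₀, m₁, m₂] t := by
  unfold levelFourIntegrandIm
  rw [stub_conj_integrandC_conjWord, Complex.conj_im]

/-- A 3-letter word is convergent iff its conjugate is (letter conjugation fixes the poles `1`
and `0`). [folklore] -/
theorem stub_conj_isConvergent_iff (m₀ m₁ m₂ : Fin 5) :
    LevelFour.IsConvergent (LevelFour.conjWord [m₀, m₁, m₂]) ↔
      LevelFour.IsConvergent [m₀, m₁, m₂] := by
  revert m₀ m₁ m₂
  decide

/-- The real-part row for a convergent word: `[Re W̄] - [Re W] ∈ KZ.relations`, an integrand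
congruence on the common domain `openOrderedSimplex 3`. [cite: KontsevichZagier2001, §1.2 rule (1)] -/
theorem stub_conj_re_row (m₀ m₁ m₂ : Fin 5) (hW : LevelFour.IsConvergent [m₀, m₁, m₂])
    (hW' : LevelFour.IsConvergent (LevelFour.conjWord [m₀, m₁, m₂])) :
    of (levelFourRepRe (LevelFour.conjWord [m₀, m₁, m₂]) (integrableOn_levelFourIntegrandC hW')) -
      of (levelFourRepRe [m₀, m₁, m₂] (integrableOn_levelFourIntegrandC hW)) ∈ relations := by
  refine of_sub_of_mem_relations_of_eqOn ?_ fun t _ => ?_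
  · exact (levelFourRepRe_domain [m₀, m₁, m₂] _).trans
      (levelFourRepRe_domain (LevelFour.conjWord [m₀, m₁, m₂]) _).symm
  · exact (congrFun (levelFourRepRe_integrand (LevelFour.conjWord [m₀, m₁, m₂])
        (integrableOn_levelFourIntegrandC hW')) t).trans
      ((stub_conj_integrandRe_conjWord m₀ m₁ m₂ t).trans
        (congrFun (levelFourRepRe_integrand [m₀, m₁, m₂]
          (integrableOn_levelFourIntegrandC hW)) t).symm)

/-- The imaginary-part row for a convergent word: `[Im W̄] + [Im W] ∈ KZ.relations` (opposite
integrands on the common domain). [cite: KontsevichZagier2001, §1.2 rule (1)] -/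
theorem stub_conj_im_row (m₀ m₁ m₂ : Fin 5) (hW : LevelFour.IsConvergent [m₀, m₁, m₂])
    (hW' : LevelFour.IsConvergent (LevelFour.conjWord [m₀, m₁, m₂])) :
    of (levelFourRepIm (LevelFour.conjWord [m₀, m₁, m₂]) (integrableOn_levelFourIntegrandC hW')) +
      of (levelFourRepIm [m₀, m₁, m₂] (integrableOn_levelFourIntegrandC hW)) ∈ relations := by
  refine of_add_of_mem_relations_of_eqOn_neg ?_ fun t _ => ?_
  · exact (levelFourRepIm_domain [m₀, m₁, m₂] _).trans
      (levelFourRepIm_domain (LevelFour.conjWord [m₀, m₁, m₂]) _).symm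
  · have h2 : levelFourIntegrandIm [m₀, m₁, m₂] t =
        -levelFourIntegrandIm (LevelFour.conjWord [m₀, m₁, m₂]) t := by
      rw [stub_conj_integrandIm_conjWord, neg_neg]
    exact (congrFun (levelFourRepIm_integrand [m₀, m₁, m₂]
        (integrableOn_levelFourIntegrandC hW)) t).trans
      (h2.trans (congrArg Neg.neg (congrFun (levelFourRepIm_integrand
        (LevelFour.conjWord [m₀, m₁, m₂]) (integrableOn_levelFourIntegrandC hW')) t).symm))

/-- The vanishing row for a convergent self-conjugate word: every letter is a real pole, the
complex integrand is pointwise real, so `[Im W] ∈ KZ.relations`.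
[cite: KontsevichZagier2001, §1.2 rule (1)] -/
theorem stub_conj_im_zero_row (m₀ m₁ m₂ : Fin 5) (hW : LevelFour.IsConvergent [m₀, m₁, m₂])
    (heq : LevelFour.conjWord [m₀, m₁, m₂] = [m₀, m₁, m₂]) :
    of (levelFourRepIm [m₀, m₁, m₂] (integrableOn_levelFourIntegrandC hW)) ∈ relations := by
  have h' : LevelFour.conjLetter m₀ = m₀ ∧ LevelFour.conjLetter m₁ = m₁ ∧
      LevelFour.conjLetter m₂ = m₂ := by
    simpa [LevelFour.conjWord] using heq
  refine of_mem_relations_of_eqOn_zero _ fun t _ => ?_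
  rw [levelFourRepIm_integrand]
  show levelFourIntegrandIm [m₀, m₁, m₂] t = 0
  have hc : starRingEnd ℂ (levelFourIntegrandC [m₀, m₁, m₂] t) =
      levelFourIntegrandC [m₀, m₁, m₂] t := by
    rw [← stub_conj_integrandC_conjWord m₀ m₁ m₂ t]
    show levelFourIntegrandC
      [LevelFour.conjLetter m₀, LevelFour.conjLetter m₁, LevelFour.conjLetter m₂] t = _
    rw [stub_conj_integrandC_three, stub_conj_integrandC_three, h'.1, h'.2.1, h'.2.2]
  exact Complex.conj_eq_iff_im.1 hc

/-- **Stub `stub_conj`** (free rows): complex conjugation of all letters conjugates the word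
integrand pointwise, so `Re I(W̄) − Re I(W)`, `Im I(W̄) + Im I(W)` are integrand congruences
(rule (1)), and a self-conjugate word has identically vanishing imaginary integrand; for a
non-convergent word everything is `0`. Here `Zr`/`Zi` are any class functions agreeing with the
canonical classes `of (levelFourRepRe/Im W _)` on convergent words and vanishing elsewhere.
[cite: KontsevichZagier2001, §1.2 rule (1)] -/
theorem stub_conj (Zr Zi : List (Fin 5) → FormalRep)
    (hZr : ∀ (W : List (Fin 5)) (h : LevelFour.IsConvergent W),
      Zr W = of (levelFourRepRe W (integrableOn_levelFourIntegrandC h)))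
    (hZr₀ : ∀ W : List (Fin 5), ¬ LevelFour.IsConvergent W → Zr W = 0)
    (hZi : ∀ (W : List (Fin 5)) (h : LevelFour.IsConvergent W),
      Zi W = of (levelFourRepIm W (integrableOn_levelFourIntegrandC h)))
    (hZi₀ : ∀ W : List (Fin 5), ¬ LevelFour.IsConvergent W → Zi W = 0)
    (m₀ m₁ m₂ : Fin 5) :
    Zr (LevelFour.conjWord [m₀, m₁, m₂]) - Zr [m₀, m₁, m₂] ∈ relations ∧
    Zi (LevelFour.conjWord [m₀, m₁, m₂]) + Zi [m₀, m₁, m₂] ∈ relations ∧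
    (LevelFour.conjWord [m₀, m₁, m₂] = [m₀, m₁, m₂] → Zi [m₀, m₁, m₂] ∈ relations) := by
  by_cases hW : LevelFour.IsConvergent [m₀, m₁, m₂]
  · have hW' : LevelFour.IsConvergent (LevelFour.conjWord [m₀, m₁, m₂]) :=
      (stub_conj_isConvergent_iff m₀ m₁ m₂).2 hW
    rw [hZr _ hW', hZr _ hW, hZi _ hW', hZi _ hW]
    exact ⟨stub_conj_re_row m₀ m₁ m₂ hW hW', stub_conj_im_row m₀ m₁ m₂ hW hW',
      stub_conj_im_zero_row m₀ m₁ m₂ hW⟩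
  · have hW' : ¬ LevelFour.IsConvergent (LevelFour.conjWord [m₀, m₁, m₂]) :=
      fun h => hW ((stub_conj_isConvergent_iff m₀ m₁ m₂).1 h)
    rw [hZr₀ _ hW', hZr₀ _ hW, hZi₀ _ hW', hZi₀ _ hW, sub_zero, add_zero]
    exact ⟨relations.zero_mem, relations.zero_mem, fun _ => relations.zero_mem⟩

end Summit.KontsevichZagierPeriods.OctahedralSymmetry.ZhaoRelationInKZ

end
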